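import Summits.QuantumFields.YangMills.Theorems.ParabolicTrajectoryTunedSequenceExistsPVGGlue

/-!
# `SplitReadbackS` — read-back of `children-S.json` against the LANDED names (lead c12 of stmt-QuantumFields-10524)

The four texts below are byte-identical to those of `SplitChildrenS.lean` (which elaborates them with the ROUTE FILE's
imports + `Literature.MathematicalPhysics.QuantumFieldTheory.QCDTimeReflection` only; crux workfiles are not importable
modules on the farm, hence the duplication).  Here each route-side rendering is certified DEFINITIONALLY (`Iff.rfl`)
equal to the Theorems-side name that the landed glue consumes, and the `--glue-by` declarations typecheck against them:

* γ_PVG (three children): `glue_by_sharp : SharpCorrelatorLowerBound → MirrorCeilingIn → MirrorCeilingOut →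
  TunedSequenceExistsPVG := PVGGlue.tunedSequenceExistsPVG_of_sharp_mirror_subs`;
* β_PVG (four children = the registered stub bodies): `glue_by_slack`.

Workfile only; nothing is asserted.
-/

namespace Summit.QuantumFields.YangMills.Theses.ParabolicTrajectory.SplitReadbackS

open scoped BigOperators Topology Manifold Classical MeasureTheory ProbabilityTheory Matrix InnerProductSpace ComplexConjugate ContinuousMap
open Filter Set Function TopologicalSpace MeasureTheory
open Summit.QuantumFields.YangMills.Theorems.TunedSequenceExists

/-- Child 1 (crux) `SharpCorrelatorLowerBound` — X_P: the quantitative `ξ(β) → ∞` with canonical amplitude, in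
continuous intrinsic units, for the corner action density (≡ `UnitsCore.SharpLowerBoundAll`). -/
def SharpCorrelatorLowerBound : Prop :=
  ∀ (G : Type) [Group G] [TopologicalSpace G] [IsTopologicalGroup G] [CompactSpace G], Literature.MathematicalPhysics.QuantumFieldTheory.IsCompactSimpleLieGroup G → letI : MeasurableSpace G := borel G; haveI : BorelSpace G := ⟨rfl⟩; ∀ (r : Literature.MathematicalPhysics.QuantumFieldTheory.LatticeRep G), ∃ a : ℝ → ℝ, Continuous a ∧ (∀ β, 0 < a β) ∧ Filter.Tendsto a Filter.atTop (nhds 0) ∧ ∃ (s₁ s₂ ε β₅ Λ₅ : ℝ), 0 < s₁ ∧ s₁ ≤ s₂ ∧ 0 < ε ∧ ∀ β : ℝ, β₅ ≤ β → ∀ (L D : ℕ), Λ₅ ≤ a β * L → s₁ ≤ D * a β → D * a β ≤ s₂ → ε ≤ (D : ℝ) ^ 8 * Literature.MathematicalPhysics.QuantumFieldTheory.latticeConnectedCorr r.ρ β (2 * L + 1) r.curvature.F r.curvature.F D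

/-- Child 2 (crux) `MirrorCeilingIn` — A_in: canonical upper bound for the inward mirror correlator
(≡ `FixedAspectSplit.MirrorBoundInAll`). -/
def MirrorCeilingIn : Prop :=
  ∀ (G : Type) [Group G] [TopologicalSpace G] [IsTopologicalGroup G] [CompactSpace G], Literature.MathematicalPhysics.QuantumFieldTheory.IsCompactSimpleLieGroup G → letI : MeasurableSpace G := borel G; haveI : BorelSpace G := ⟨rfl⟩; ∀ (r : Literature.MathematicalPhysics.QuantumFieldTheory.LatticeRep G), ∃ (β₁ K : ℝ), ∀ β : ℝ, β₁ ≤ β → ∀ (L D : ℕ), D ≤ L → (D : ℝ) ^ 8 * |Literature.MathematicalPhysics.QuantumFieldTheory.latticeConnectedCorr r.ρ β (2 * L + 1) r.curvature.F (fun V => r.curvature.F (Literature.MathematicalPhysics.QuantumFieldTheory.cfgReflect V)) D| ≤ K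

/-- Child 3 (crux) `MirrorCeilingOut` — A_out: canonical upper bound for the outward mirror correlator
(≡ `FixedAspectSplit.MirrorBoundOutAll`). -/
def MirrorCeilingOut : Prop :=
  ∀ (G : Type) [Group G] [TopologicalSpace G] [IsTopologicalGroup G] [CompactSpace G], Literature.MathematicalPhysics.QuantumFieldTheory.IsCompactSimpleLieGroup G → letI : MeasurableSpace G := borel G; haveI : BorelSpace G := ⟨rfl⟩; ∀ (r : Literature.MathematicalPhysics.QuantumFieldTheory.LatticeRep G), ∃ (β₁ K : ℝ), ∀ β : ℝ, β₁ ≤ β → ∀ (L D : ℕ), D ≤ L → (D : ℝ) ^ 8 * |Literature.MathematicalPhysics.QuantumFieldTheory.latticeConnectedCorr r.ρ β (2 * L + 1) (fun V => r.curvature.F (Literature.MathematicalPhysics.QuantumFieldTheory.cfgReflect V)) r.curvature.F D| ≤ K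

/-- Parent (restated crux) `TunedSequenceExistsPVG` — banner item (b), verbatim the S_PVG text of RESTATE-B-c9.md
with Literature names fully qualified (≡ `TwoOrbitSynchronisation.TunedSequenceExistsPVG`). -/
def TunedSequenceExistsPVG : Prop :=
  ∀ (G : Type) [Group G] [TopologicalSpace G] [IsTopologicalGroup G] [CompactSpace G], Literature.MathematicalPhysics.QuantumFieldTheory.IsCompactSimpleLieGroup G → letI : MeasurableSpace G := borel G; haveI : BorelSpace G := ⟨rfl⟩; ∀ (r : Literature.MathematicalPhysics.QuantumFieldTheory.LatticeRep G) (M : ℕ), 2 ≤ M → ∃ θ₀ : ℝ, 0 < θ₀ ∧ ∀ θ : ℝ, 0 < θ → θ < θ₀ → ∃ (sch : Literature.MathematicalPhysics.QuantumFieldTheory.SpeciesScheme (Literature.MathematicalPhysics.QuantumFieldTheory.YMSpecies G)) (n : ℕ → ℕ), (∀ k, sch.a k = ((M : ℝ) ^ n k)⁻¹) ∧ Filter.Tendsto sch.β Filter.atTop Filter.atTop ∧ (∀ t : ℕ, 0 < t → ∃ c : ℝ, Filter.Tendsto (fun k => ((M : ℝ) ^ n k) ^ 8 * Literature.MathematicalPhysics.QuantumFieldTheory.latticeConnectedCorr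 r.ρ (sch.β k) (sch.side k) r.curvature.F r.curvature.F (t * M ^ n k)) Filter.atTop (nhds c)) ∧ Filter.Tendsto (fun k => ((M : ℝ) ^ n k) ^ 8 * Literature.MathematicalPhysics.QuantumFieldTheory.latticeConnectedCorr r.ρ (sch.β k) (sch.side k) r.curvature.F r.curvature.F (M ^ n k)) Filter.atTop (nhds θ) ∧ (∃ N : ℕ, 1 ≤ N ∧ ∀ᶠ k in Filter.atTop, (sch.a k)⁻¹ ≤ (sch.a k * (sch.L k : ℝ)) ^ N)

example : SharpCorrelatorLowerBound ↔ UnitsCore.SharpLowerBoundAll := Iff.rfl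
example : MirrorCeilingIn ↔ FixedAspectSplit.MirrorBoundInAll := Iff.rfl
example : MirrorCeilingOut ↔ FixedAspectSplit.MirrorBoundOutAll := Iff.rfl
example : TunedSequenceExistsPVG ↔
    Summit.QuantumFields.YangMills.Cruxes.ContinuumLimitOnTrajectory.TwoOrbitSynchronisation.TunedSequenceExistsPVG :=
  Iff.rfl

/-- γ_PVG: the `--glue-by` declaration, read back on the route-side renderings. -/
theorem glue_by_sharp : SharpCorrelatorLowerBound → MirrorCeilingIn → MirrorCeilingOut → TunedSequenceExistsPVG :=
  PVGGlue.tunedSequenceExistsPVG_of_sharp_mirror_subs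

/-- β_PVG: the four-child `--glue-by` declaration on the registered stub bodies (Theorems-side names for the first
two; their route-side renderings are the bodies of `stub_femtoLowerBound` / `stub_volumeSlack`). -/
theorem glue_by_slack : FixedAspectSplit.FemtoLowerBoundAll → FixedAspectSplit.VolumeMonotoneSlackAll →
    MirrorCeilingIn → MirrorCeilingOut → TunedSequenceExistsPVG :=
  PVGGlue.tunedSequenceExistsPVG_of_slack_mirror_subs

/-- After the restatement the rev-7 conjunct (S) is still reachable from the children (consistency). -/
example (hX : SharpCorrelatorLowerBound) (hIn : MirrorCeilingIn) (hOut : MirrorCeilingOut) : TunedSequenceExists :=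
  Summit.QuantumFields.YangMills.Cruxes.ContinuumLimitOnTrajectory.TwoOrbitSynchronisation.tunedSequenceExists_of_PVG
    (glue_by_sharp hX hIn hOut)

end Summit.QuantumFields.YangMills.Theses.ParabolicTrajectory.SplitReadbackS
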